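import Summits.KontsevichZagierPeriods.KontsevichZagierPeriods.Theses.LinRedNormalForm
import Literature.NumberTheory.Transcendental.BrownZagierFormulaProofs
import Mathlib.LinearAlgebra.Dimension.OrzechProperty
import Mathlib.LinearAlgebra.LinearIndependent.Lemmas

/-!
# Crux `HoffmanIndependence` (stmt-KontsevichZagierPeriods-15045), line `weight_split` —
# stub `stub_levelOne_iff`: the LEVEL-ONE TYPING of the crux

The crux `Theses.LinRedNormalForm.HoffmanIndependence` asks for the `ℚ`-linear independence of ALL
real Hoffman values `ζ(u)`, `u ∈ {2,3}^×`. Brown's *level* of a Hoffman word is its number of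
letters `3`. This file types the level-`≤ 1` slice of the crux — the infinite sub-family of the
words `{2}^m` (weight `2m`) and `2^b 3 2^a` (weight `2(a+b)+3`), which mixes all weights — in
classical numbers:

* `stub_levelOne_iff` (the registered stub, by name and signature): the level-`≤ 1` Hoffman values
  are `ℚ`-linearly independent **iff** the family `(m, 0) ↦ π^{2m}`, `(m, r) ↦ π^{2m} ζ(2r+1)`
  (`r ≥ 1`) on `ℕ × ℕ` is `ℚ`-linearly independent.

Proof. Weight by weight the two families span the same `ℚ`-subspace of `ℝ` and have the same
number of elements: in weight `2m`, `ζ({2}^m) = π^{2m}/(2m+1)!` (`multipleZeta_replicate_two`);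
in weight `2n+1`, Zagier's theorem (`LaiLupuOrr.zagier_theorem`, proved in the tree) writes each of
the `n` values `ζ(2^b 3 2^{n-1-b})` as a rational combination of the `n` products
`π^{2(n-1-j)} ζ(2j+3)`, and the matrix of this system — the Zagier matrix — is invertible by
Brown's `2`-adic argument (`Brown2012.isUnit_zagierMatrix`, proved in the tree), so conversely each
product is a rational combination of the level-one values (`Brown2012.mem_of_isUnit_of_eq_sum_smul`).
For any family and any weight map, linear independence is EXACTLY (independence of the fibre
spans) ∧ (independence inside each fibre) (`linearIndependent_iff_iSupIndep_and_fibres`, the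
generic form of the line's split glue), and inside a finite fibre independence is the numerical
condition `#fibre = dim span` (`linearIndependent_iff_card_eq_finrank_span`); both conditions only
see the fibre spans, whence `linearIndependent_iff_of_mem_span_fibre`, applied on the common
parametrisation `ℕ × ℕ ≃ {u ∈ {2,3}^× : #₃(u) ≤ 1}`, `(m, 0) ↦ {2}^m`, `(m, r+1) ↦ 2^m 3 2^r`.

With the sibling stub `stub_linearIndependent_mul_pow_iff` (transcendental rescaling, `π²`
transcendental) the right-hand side is the statement "`1, ζ(3), ζ(5), ζ(7), …` are linearly
independent over the ring `ℚ[π²]`": the depth-one shadow of the crux.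

No new definitions; this file supports the item, it does not close it.
[cite: Zagier2012, Theorem 1] [cite: Brown2012, Theorems 4.1, 7.3 and 7.4] [cite: Hoffman1992, Corollary 2.3]
-/

noncomputable section

namespace Summit.KontsevichZagierPeriods.LinRedNormalForm.HoffmanIndependence

open Literature.NumberTheory.Transcendental MZV Brown2012 Real
open scoped Nat

/-! ## §1 Generic linear algebra: independence = grading of the fibre spans × fibrewise independence -/

/-- The range of a family restricted to a fibre of a map `w` is the image of that fibre.
[folklore] -/
theorem range_restrict_fibre {ι α β : Type*} (w : ι → α) (f : ι → β) (a : α) :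
    Set.range (fun i : {i // w i = a} => f i.1) = f '' {i | w i = a} := by
  ext x
  simp

section Generic

variable {K M ι α : Type*} [Field K] [AddCommGroup M] [Module K M]

/-- **Generic split.** For any map `w : ι → α` ("weight"), a family `f : ι → M` over a field is
linearly independent iff (a) the spans of its fibres `f '' w⁻¹{a}` are independent subspaces
(`iSupIndep`) and (b) the restriction of `f` to every fibre is linearly independent.
[folklore] -/
theorem linearIndependent_iff_iSupIndep_and_fibres (w : ι → α) (f : ι → M) :
    LinearIndependent K f ↔
      iSupIndep (fun a => Submodule.span K (f '' {i | w i = a})) ∧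
        ∀ a, LinearIndependent K (fun i : {i // w i = a} => f i.1) := by
  constructor
  · intro h
    refine ⟨?_, fun a => h.comp _ Subtype.val_injective⟩
    rw [iSupIndep_def]
    intro a
    have hdisj : Disjoint {i | w i = a} {i | w i ≠ a} :=
      Set.disjoint_left.2 fun i hi hi' => hi' hi
    refine (h.disjoint_span_image hdisj).mono_right (iSup₂_le fun b hb => ?_)
    exact Submodule.span_mono (Set.image_mono fun i hi hia => hb ((show w i = b from hi).symm.trans hia))
  · rintro ⟨hG, hW⟩
    have hsigma : LinearIndependent K fun ji : Σ a, {i // w i = a} => f ji.2.1 := by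
      refine linearIndependent_iUnion_finite (f := fun a (i : {i // w i = a}) => f i.1) hW
        fun a t _ hat => ?_
      have hr : ∀ b, Set.range ((fun a (i : {i // w i = a}) => f i.1) b) = f '' {i | w i = b} :=
        fun b => range_restrict_fibre w f b
      simp only [hr]
      exact hG.disjoint_biSup hat
    let e : ι → Σ a, {i // w i = a} := fun i => ⟨w i, ⟨i, rfl⟩⟩
    have he : Function.Injective e :=
      Function.Injective.of_comp (f := fun ji : Σ a, {i // w i = a} => ji.2.1) fun _ _ hab => hab
    exact hsigma.comp e he

/-- **Fibrewise comparison.** Two families on the same index type, graded by a map `w` with finite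
fibres, such that every `f i` lies in the span of the `g`-fibre of `w i` and conversely, are
simultaneously linearly independent: both independences are
(grading of the common fibre spans) ∧ (∀ a, #fibre = dim of the fibre span). [folklore] -/
theorem linearIndependent_iff_of_mem_span_fibre (w : ι → α) (hw : ∀ a, Finite {i // w i = a})
    {f g : ι → M} (hfg : ∀ i, f i ∈ Submodule.span K (g '' {j | w j = w i}))
    (hgf : ∀ i, g i ∈ Submodule.span K (f '' {j | w j = w i})) :
    LinearIndependent K f ↔ LinearIndependent K g := by
  have hle : ∀ {f g : ι → M}, (∀ i, f i ∈ Submodule.span K (g '' {j | w j = w i})) →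
      ∀ a, Submodule.span K (f '' {i | w i = a}) ≤ Submodule.span K (g '' {i | w i = a}) := by
    intro f g hfg a
    refine Submodule.span_le.2 ?_
    rintro _ ⟨i, hi, rfl⟩
    have h := hfg i
    rwa [show w i = a from hi] at h
  have hspan : ∀ a, Submodule.span K (f '' {i | w i = a}) = Submodule.span K (g '' {i | w i = a}) :=
    fun a => le_antisymm (hle hfg a) (hle hgf a)
  rw [linearIndependent_iff_iSupIndep_and_fibres w f, linearIndependent_iff_iSupIndep_and_fibres w g,
    show (fun a => Submodule.span K (f '' {i | w i = a})) =
      fun a => Submodule.span K (g '' {i | w i = a}) from funext hspan]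
  refine and_congr Iff.rfl (forall_congr' fun a => ?_)
  haveI := hw a
  haveI : Fintype {i // w i = a} := Fintype.ofFinite _
  rw [linearIndependent_iff_card_eq_finrank_span, linearIndependent_iff_card_eq_finrank_span,
    Set.finrank, Set.finrank, range_restrict_fibre w f a, range_restrict_fibre w g a, hspan a]

end Generic

/-! ## §2 The level-`≤ 1` Hoffman words: `{2}^m` and `2^b 3 2^a` -/

/-- `{2}^m` is a Hoffman word with no letter `3`. [folklore] -/
theorem isHoffman_replicate_two_and_count (m : ℕ) :
    IsHoffman (List.replicate m 2) ∧ (List.replicate m 2).count 3 ≤ 1 :=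
  ⟨fun _ hi => Or.inl (List.eq_of_mem_replicate hi), by simp [List.count_replicate]⟩

/-- `2^b 3 2^a` is a Hoffman word with exactly one letter `3`. [folklore] -/
theorem isHoffman_twos_three_twos_and_count (a b : ℕ) :
    IsHoffman (List.replicate b 2 ++ 3 :: List.replicate a 2) ∧
      (List.replicate b 2 ++ 3 :: List.replicate a 2).count 3 ≤ 1 :=
  ⟨isHoffman_twos_three_twos a b, by simp [List.count_append, List.count_replicate]⟩

/-- A Hoffman word without the letter `3` is `{2}^m`. [folklore] -/
theorem eq_replicate_two_of_isHoffman {u : List ℕ} (hu : IsHoffman u) (h0 : u.count 3 = 0) :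
    u = List.replicate u.length 2 := by
  refine List.eq_replicate_of_mem fun b hb => ?_
  rcases hu b hb with rfl | rfl
  · rfl
  · exact absurd hb (List.count_eq_zero.1 h0)

/-- A Hoffman word with exactly one letter `3` is `2^b 3 2^a`. [folklore] -/
theorem exists_eq_twos_three_twos_of_isHoffman {u : List ℕ} (hu : IsHoffman u) (h1 : u.count 3 = 1) :
    ∃ b a : ℕ, u = List.replicate b 2 ++ 3 :: List.replicate a 2 := by
  induction u with
  | nil => simp at h1
  | cons x u ih =>
    have hx : x = 2 ∨ x = 3 := hu x (by simp)
    have hu' : IsHoffman u := fun i hi => hu i (List.mem_cons_of_mem x hi)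
    rcases hx with rfl | rfl
    · have h1' : u.count 3 = 1 := by simpa [List.count_cons] using h1
      obtain ⟨b, a, rfl⟩ := ih hu' h1'
      exact ⟨b + 1, a, by simp [List.replicate_succ]⟩
    · have h0 : u.count 3 = 0 := by simpa [List.count_cons] using h1
      refine ⟨0, u.length, ?_⟩
      rw [← eq_replicate_two_of_isHoffman hu' h0]
      simp

/-- The common parametrisation `(m, 0) ↦ {2}^m`, `(m, r+1) ↦ 2^m 3 2^r` of the level-`≤ 1` Hoffman
words by `ℕ × ℕ` is injective (the number of leading `2`s and the length determine the pair).
[folklore] -/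
theorem levelOneWord_injective : Function.Injective fun p : ℕ × ℕ =>
    List.replicate p.1 2 ++ (if p.2 = 0 then ([] : List ℕ) else 3 :: List.replicate (p.2 - 1) 2) := by
  have htake : ∀ p : ℕ × ℕ, ((List.replicate p.1 2 ++
      (if p.2 = 0 then ([] : List ℕ) else 3 :: List.replicate (p.2 - 1) 2)).takeWhile
        (fun x => decide (x = 2))).length = p.1 := by
    rintro ⟨m, r⟩
    rw [List.takeWhile_append_of_pos (fun a ha => by rw [List.eq_of_mem_replicate ha]; decide)]
    split_ifs <;> simp
  have hlen : ∀ p : ℕ × ℕ, (List.replicate p.1 2 ++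
      (if p.2 = 0 then ([] : List ℕ) else 3 :: List.replicate (p.2 - 1) 2)).length = p.1 + p.2 := by
    rintro ⟨m, r⟩
    dsimp only
    split_ifs with h
    · simp [h]
    · simp only [List.length_append, List.length_replicate, List.length_cons]
      omega
  intro p q hpq
  have h1 : p.1 = q.1 := by
    have h := congrArg (fun l : List ℕ => (l.takeWhile (fun x => decide (x = 2))).length) hpq
    simpa only [htake] using h
  have h2 : p.1 + p.2 = q.1 + q.2 := by
    have h := congrArg List.length hpq
    simpa only [hlen] using h
  exact Prod.ext h1 (by omega)

/-- … and surjective onto the Hoffman words with at most one letter `3`. [folklore] -/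
theorem exists_levelOneWord_eq {u : List ℕ} (hu : IsHoffman u) (hc : u.count 3 ≤ 1) :
    ∃ p : ℕ × ℕ, List.replicate p.1 2 ++
      (if p.2 = 0 then ([] : List ℕ) else 3 :: List.replicate (p.2 - 1) 2) = u := by
  rcases Nat.le_one_iff_eq_zero_or_eq_one.1 hc with h0 | h1
  · exact ⟨(u.length, 0), by simpa using (eq_replicate_two_of_isHoffman hu h0).symm⟩
  · obtain ⟨b, a, rfl⟩ := exists_eq_twos_three_twos_of_isHoffman hu h1
    exact ⟨(b, a + 1), by simp⟩

/-- Every word of the parametrisation is a Hoffman word with at most one letter `3`. [folklore] -/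
theorem isHoffman_levelOneWord_and_count (p : ℕ × ℕ) :
    IsHoffman (List.replicate p.1 2 ++
        (if p.2 = 0 then ([] : List ℕ) else 3 :: List.replicate (p.2 - 1) 2)) ∧
      (List.replicate p.1 2 ++
        (if p.2 = 0 then ([] : List ℕ) else 3 :: List.replicate (p.2 - 1) 2)).count 3 ≤ 1 := by
  obtain ⟨m, r⟩ := p
  by_cases hr : r = 0
  · simpa [hr] using isHoffman_replicate_two_and_count m
  · simpa [hr] using isHoffman_twos_three_twos_and_count (r - 1) m

/-! ## §3 Weight by weight, the two families span the same `ℚ`-subspace -/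

/-- `ζ({2}^m) ∈ ℚ·π^{2m}` (`ζ({2}^m) = π^{2m}/(2m+1)!`). [cite: Hoffman1992, Corollary 2.3] -/
theorem multipleZeta_replicate_two_mem_span_pi_pow (m : ℕ) :
    multipleZeta (List.replicate m 2) ∈ Submodule.span ℚ ({π ^ (2 * m)} : Set ℝ) := by
  rw [Submodule.mem_span_singleton, multipleZeta_replicate_two]
  refine ⟨(((2 * m + 1)! : ℕ) : ℚ)⁻¹, ?_⟩
  rw [Rat.smul_def]
  push_cast
  field_simp

/-- `π^{2m} ∈ ℚ·ζ({2}^m)` (`π^{2m} = (2m+1)! ζ({2}^m)`). [cite: Hoffman1992, Corollary 2.3] -/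
theorem pi_pow_mem_span_multipleZeta_replicate_two (m : ℕ) :
    π ^ (2 * m) ∈ Submodule.span ℚ ({multipleZeta (List.replicate m 2)} : Set ℝ) := by
  rw [Submodule.mem_span_singleton, multipleZeta_replicate_two]
  refine ⟨(((2 * m + 1)! : ℕ) : ℚ), ?_⟩
  rw [Rat.smul_def]
  push_cast
  field_simp

/-- **Zagier's theorem as a span statement**: `ζ(2^b 3 2^a)` is a rational combination of the
`a+b+1` products `π^{2i} ζ(2k+3)`, `i + k = a + b` (`ζ({2}^i) = π^{2i}/(2i+1)!`).
[cite: Zagier2012, Theorem 1] -/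
theorem multipleZeta_twos_three_twos_mem_span (a b : ℕ) :
    multipleZeta (List.replicate b 2 ++ 3 :: List.replicate a 2) ∈
      Submodule.span ℚ ((fun q : ℕ × ℕ => π ^ (2 * q.1) * multipleZeta [2 * q.2 + 3]) ''
        {q | q.1 + q.2 = a + b}) := by
  rw [LaiLupuOrr.zagier_theorem a b, Finset.mul_sum]
  refine Submodule.sum_mem _ fun r hr => ?_
  rw [Finset.mem_range] at hr
  have hf : (((2 * (a + b - r) + 1)! : ℕ) : ℝ) ≠ 0 := by positivity
  have key : 2 * ((-1 : ℝ) ^ (r + 1) * ((zagierA (r + 1) a - zagierB (r + 1) b : ℚ) : ℝ) *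
      (multipleZeta [2 * r + 3] * multipleZeta (List.replicate (a + b - r) 2))) =
      ((2 * (-1 : ℚ) ^ (r + 1) * (zagierA (r + 1) a - zagierB (r + 1) b) /
          ((2 * (a + b - r) + 1)! : ℕ) : ℚ) : ℝ) * (π ^ (2 * (a + b - r)) * multipleZeta [2 * r + 3]) := by
    rw [multipleZeta_replicate_two]
    push_cast
    field_simp
  rw [key, ← Rat.smul_def]
  exact Submodule.smul_mem _ _ (Submodule.subset_span ⟨(a + b - r, r), by simp; omega, rfl⟩)

/-- **The converse inclusion (Brown's `2`-adic inversion of the Zagier matrix)**: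
`π^{2i} ζ(2j+3)` is a rational combination of the `i+j+1` level-one Hoffman values `ζ(2^b 3 2^a)`,
`a + b = i + j`, of the same weight `2(i+j)+3` — the system of Zagier's theorem in weight `2n+1`,
`n = i+j+1`, has the invertible Zagier matrix (`Brown2012.isUnit_zagierMatrix`), so it can be
solved for the products inside the span of the level-one values
(`Brown2012.mem_of_isUnit_of_eq_sum_smul`). [cite: Brown2012, Theorems 4.1, 7.3 and 7.4] -/
theorem pi_pow_mul_multipleZeta_odd_mem_span_levelOne (i j : ℕ) :
    π ^ (2 * i) * multipleZeta [2 * j + 3] ∈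
      Submodule.span ℚ ((fun q : ℕ × ℕ =>
        multipleZeta (List.replicate q.1 2 ++ 3 :: List.replicate q.2 2)) '' {q | q.1 + q.2 = i + j}) := by
  -- weight `2n+1`, `n = i + j + 1`; the `n` level-one values `H_b = ζ(2^b 3 2^{n-1-b})`
  set n := i + j + 1 with hn
  have hj : j < n := by omega
  set S : Submodule ℚ ℝ := Submodule.span ℚ ((fun q : ℕ × ℕ =>
        multipleZeta (List.replicate q.1 2 ++ 3 :: List.replicate q.2 2)) '' {q | q.1 + q.2 = i + j})
    with hS
  -- the system `H = Z⁽ⁿ⁾ • P` of Zagier's theorem in weight `2n+1`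
  set P : Fin n → ℝ := fun j => multipleZeta [2 * (j : ℕ) + 3] * multipleZeta (List.replicate (n - 1 - j) 2)
    with hP
  set H : Fin n → ℝ := fun b => multipleZeta (List.replicate (b : ℕ) 2 ++ 3 :: List.replicate (n - 1 - b) 2)
    with hH
  have hsys : ∀ b : Fin n, H b = ∑ j : Fin n, zagierMatrix n b j • P j := by
    intro b
    rw [hH, hP]
    simp only
    rw [LaiLupuOrr.zagier_theorem_hZ n b b.2, Finset.mul_sum, ← Fin.sum_univ_eq_sum_range]
    refine Finset.sum_congr rfl fun j _ => ?_
    rw [zagierMatrix_apply, Rat.smul_def]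
    push_cast
    ring
  have hHS : ∀ b : Fin n, H b ∈ S := fun b =>
    Submodule.subset_span ⟨((b : ℕ), n - 1 - b), by have := b.2; simp; omega, rfl⟩
  have h := mem_of_isUnit_of_eq_sum_smul (zagierMatrix n) (isUnit_zagierMatrix n) S P H hsys hHS ⟨j, hj⟩
  have h' : multipleZeta [2 * j + 3] * multipleZeta (List.replicate (n - 1 - j) 2) ∈ S := by
    simpa [hP] using h
  rw [multipleZeta_replicate_two, show n - 1 - j = i by omega] at h'
  have hf : ((Nat.factorial (2 * i + 1) : ℕ) : ℝ) ≠ 0 := by positivity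
  have key : π ^ (2 * i) * multipleZeta [2 * j + 3] =
      ((Nat.factorial (2 * i + 1) : ℕ) : ℚ) •
        (multipleZeta [2 * j + 3] * (π ^ (2 * i) / (Nat.factorial (2 * i + 1) : ℝ))) := by
    rw [Rat.smul_def]
    push_cast
    field_simp
  rw [key]
  exact Submodule.smul_mem _ _ h'

/-! ## §4 The level-one typing -/

/-- **The level-one typing on the common parametrisation.** The level-`≤ 1` Hoffman values
`(m, 0) ↦ ζ({2}^m)`, `(m, r+1) ↦ ζ(2^m 3 2^r)` are `ℚ`-linearly independent iff the classical family
`(m, 0) ↦ π^{2m}`, `(m, r) ↦ π^{2m} ζ(2r+1)` (`r ≥ 1`) is: both families are graded by the weight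
`(m, r) ↦ 2m + (0 | 2r+1)` with finite fibres, and fibrewise they span the same `ℚ`-subspace
(§3). [cite: Zagier2012, Theorem 1] [cite: Brown2012, Theorems 4.1, 7.3 and 7.4] -/
theorem levelOne_param_iff :
    LinearIndependent ℚ (fun p : ℕ × ℕ => multipleZeta (List.replicate p.1 2 ++
        (if p.2 = 0 then ([] : List ℕ) else 3 :: List.replicate (p.2 - 1) 2))) ↔
      LinearIndependent ℚ (fun p : ℕ × ℕ =>
        π ^ (2 * p.1) * (if p.2 = 0 then 1 else multipleZeta [2 * p.2 + 1])) := by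
  set F : ℕ × ℕ → ℝ := fun p : ℕ × ℕ => multipleZeta (List.replicate p.1 2 ++
        (if p.2 = 0 then ([] : List ℕ) else 3 :: List.replicate (p.2 - 1) 2)) with hF
  set G : ℕ × ℕ → ℝ := fun p : ℕ × ℕ =>
        π ^ (2 * p.1) * (if p.2 = 0 then 1 else multipleZeta [2 * p.2 + 1]) with hG
  -- the weight grading on `ℕ × ℕ`
  set wt : ℕ × ℕ → ℕ := fun p => 2 * p.1 + (if p.2 = 0 then 0 else 2 * p.2 + 1) with hwt
  -- values of `F`, `G`, `wt` on the two kinds of indices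
  have hF0 : ∀ m, F (m, 0) = multipleZeta (List.replicate m 2) := fun m => by simp [hF]
  have hF1 : ∀ m r, F (m, r + 1) = multipleZeta (List.replicate m 2 ++ 3 :: List.replicate r 2) :=
    fun m r => by simp [hF]
  have hG0 : ∀ m, G (m, 0) = π ^ (2 * m) := fun m => by simp [hG]
  have hG1 : ∀ m k, G (m, k + 1) = π ^ (2 * m) * multipleZeta [2 * k + 3] := fun m k => by
    rw [show 2 * k + 3 = 2 * (k + 1) + 1 by ring]
    simp [hG]
  have hwt0 : ∀ m, wt (m, 0) = 2 * m := fun m => by simp [hwt]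
  have hwt1 : ∀ m r, wt (m, r + 1) = 2 * m + (2 * (r + 1) + 1) := fun m r => by simp [hwt]
  -- the grading has finite fibres
  have hw : ∀ N : ℕ, Finite {p : ℕ × ℕ // wt p = N} := by
    intro N
    have hfin : Set.Finite {p : ℕ × ℕ | wt p = N} := by
      refine (Finset.finite_toSet (Finset.range (N + 1) ×ˢ Finset.range (N + 1))).subset ?_
      rintro ⟨m, r⟩ h
      change wt (m, r) = N at h
      simp only [hwt, Finset.coe_product, Set.mem_prod, Finset.mem_coe, Finset.mem_range] at h ⊢
      split_ifs at h <;> omega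
    exact hfin.to_subtype
  refine linearIndependent_iff_of_mem_span_fibre wt hw ?_ ?_
  · -- level-one values in the span of the products of the same weight
    rintro ⟨m, _ | r⟩
    · -- `ζ({2}^m) ∈ ℚ π^{2m}`
      rw [hF0]
      have hsub : ({π ^ (2 * m)} : Set ℝ) ⊆ G '' {j | wt j = wt (m, 0)} :=
        Set.singleton_subset_iff.2 ⟨(m, 0), rfl, hG0 m⟩
      exact Submodule.span_mono hsub (multipleZeta_replicate_two_mem_span_pi_pow m)
    · -- `ζ(2^m 3 2^r) ∈ ℚ⟨π^{2i} ζ(2k+3) : i + k = r + m⟩` (Zagier's theorem)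
      rw [hF1]
      refine Submodule.span_mono ?_ (multipleZeta_twos_three_twos_mem_span r m)
      rintro _ ⟨⟨i, k⟩, hik, rfl⟩
      refine ⟨(i, k + 1), ?_, hG1 i k⟩
      change i + k = r + m at hik
      change wt (i, k + 1) = wt (m, r + 1)
      rw [hwt1, hwt1]
      omega
  · -- products in the span of the level-one values of the same weight
    rintro ⟨m, _ | j⟩
    · -- `π^{2m} ∈ ℚ ζ({2}^m)`
      rw [hG0]
      have hsub : ({multipleZeta (List.replicate m 2)} : Set ℝ) ⊆ F '' {j | wt j = wt (m, 0)} :=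
        Set.singleton_subset_iff.2 ⟨(m, 0), rfl, hF0 m⟩
      exact Submodule.span_mono hsub (pi_pow_mem_span_multipleZeta_replicate_two m)
    · -- `π^{2m} ζ(2j+3) ∈ ℚ⟨ζ(2^b 3 2^a) : a + b = m + j⟩` (Brown's inversion)
      rw [hG1]
      refine Submodule.span_mono ?_ (pi_pow_mul_multipleZeta_odd_mem_span_levelOne m j)
      rintro _ ⟨⟨b, a⟩, hba, rfl⟩
      refine ⟨(b, a + 1), ?_, hF1 b a⟩
      change b + a = m + j at hba
      change wt (b, a + 1) = wt (m, j + 1)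
      rw [hwt1, hwt1]
      omega

/-- **STUB `stub_levelOne_iff` — the LEVEL-ONE TYPING of the crux.** The level-`≤ 1` sub-family of
`HoffmanIndependence` (Hoffman words with at most one letter `3`: `{2}^m` of weight `2m` and
`2^b 3 2^a` of weight `2(a+b)+3`) is `ℚ`-linearly independent iff the classical family
`(m, 0) ↦ π^{2m}`, `(m, r) ↦ π^{2m} ζ(2r+1)` (`r ≥ 1`) is. Weight by weight the two families have the
same cardinality and the same `ℚ`-span (`ζ({2}^m) = π^{2m}/(2m+1)!`; in weight `2n+1` Zagier's
theorem writes the `n` level-one values in the `n` products `π^{2(n-1-j)} ζ(2j+3)` through the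
invertible Zagier matrix), and for both families independence = (grading of the weight spans) ∧
(independence within each weight). [cite: Zagier2012, Theorem 1] [cite: Brown2012, Theorems 4.1 and 7.3] -/
theorem stub_levelOne_iff :
    LinearIndependent ℚ
        (fun u : {u : List ℕ // IsHoffman u ∧ u.count 3 ≤ 1} => multipleZeta u.1) ↔
      LinearIndependent ℚ (fun p : ℕ × ℕ =>
        Real.pi ^ (2 * p.1) * (if p.2 = 0 then 1 else multipleZeta [2 * p.2 + 1])) := by
  rw [← levelOne_param_iff]
  -- the common parametrisation as an equivalence of index types
  let e : ℕ × ℕ ≃ {u : List ℕ // IsHoffman u ∧ u.count 3 ≤ 1} :=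
    Equiv.ofBijective
      (fun p => ⟨List.replicate p.1 2 ++
        (if p.2 = 0 then ([] : List ℕ) else 3 :: List.replicate (p.2 - 1) 2),
          isHoffman_levelOneWord_and_count p⟩)
      ⟨fun p q hpq => levelOneWord_injective (congrArg Subtype.val hpq),
        fun u => by
          obtain ⟨p, hp⟩ := exists_levelOneWord_eq u.2.1 u.2.2
          exact ⟨p, Subtype.ext hp⟩⟩
  exact (linearIndependent_equiv' e rfl).symm

end Summit.KontsevichZagierPeriods.LinRedNormalForm.HoffmanIndependence

end
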